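import Literature.NumberTheory.Automorphic.ArchLocalSplitSingularCentralizer   -- ★ (V9): `exists_centralizer_continuousMulEquiv_of_splitSingular` (`Z(t_w z₁) ≃ₜ* U₂ × U₁`)
import Literature.NumberTheory.Automorphic.ArchLocalRegularOrbitClosed          -- ★ `locallyCompactSpace_archLocal`, `secondCountableTopology_archLocal`
import Literature.NumberTheory.Automorphic.UnitaryFormGroupUnimodular           -- ★ `modularCharacterFun_unitaryGroupOfForm_eq_one`, `modularCharacterFun_eq_one_of_continuousMulEquiv`
import Literature.NumberTheory.Automorphic.OrbitalMeasureFamilyRegular          -- ★ `modularCharacterFun_prod_eq_one`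
import Literature.NumberTheory.Automorphic.GLnAdelicIntegrationFactsProofs      -- ★ `isMulRightInvariant_of_modularCharacterFun_eq_one`
import Literature.NumberTheory.Automorphic.UnitaryGroupOfLocalTorusMeasure      -- ★ `isInvInvariant_of_isMulRightInvariant_of_isClosed`
import Literature.NumberTheory.Automorphic.LocalOrbitalMeasure                  -- ★ `isClosed_coe_centralizer_singleton`
import HarnessLib

/-!
# The centraliser of a NONCOMPACT-WALL torus point of `G_w = U(σ_w diag α)(ℂ)` is unimodular and carries an inversion-invariant Haar measure — the `νH` binder of the
# letter (J-nc) `ArchLimitFormulaNoncompactWall` DISCHARGED (Rogawski 1990 §8.2 p. 122 «`H = Z(γ₀) ≅ U(1,1) × U(1)`», §1.7 p. 6; Knapp 2002 Cor. 8.31; Folland 1995 §2.4)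

Topic `NumberTheory/Automorphic`; namespace `Literature.NumberTheory.Automorphic.UnitaryGroup`.  THEOREMS ONLY (no `def`, no instance, no notation, no axiom, no named fact,
no `sorry`).  Cell `pub/hodgecm-mathlib`, ENGINE T1 (crux H413 = `stmt-HodgeConjecture-24833`); ROAD A toward N1 = the registered stub `stub_L21` (closer ED. 25); author A-p18 (g25).

WHY.  The proved letter ★ `archLimitFormulaNoncompactWall_holds` (and every consumer of it: ★ `ArchStableOrbitalWallDerivCM`, the N1 assembly ★ `…of_chamberExtensions` through
★ `deriv_cornerExtensions_eq_of_wall02_limitFormula`) is stated «for every inversion-invariant Haar measure `νH` on the centraliser `Z(t_w z₁)` of the reference wall point» — a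
binder that statements quantifying only over the Haar measure `ν` of `G_w` (the letter N1 `ArchCentralLimitFormulaRankTwo`) must DISCHARGE inside their proofs.  This file discharges it:
* `modularCharacterFun_centralizer_circleDiagonal_wall_eq_one` — for a wall point `z₁` (`z₁ 0 = z₁ 2 ≠ z₁ 1`) of the circle torus of `archLocal L 3 (diagonal α) w` (frame guards
  `α_i ≠ 0`, `σ_w α_i` real), the centraliser `Z(t_w z₁)` is UNIMODULAR: it is `≃ₜ* U(σ_w diag(α₀,α₂))(ℂ) × U(σ_w α₁)(ℂ)` (★ (V9)), both factors are unimodular real unitary groups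
  (★ `modularCharacterFun_unitaryGroupOfForm_eq_one`), products and topological isomorphisms preserve `Δ ≡ 1`;
* **`exists_isHaarMeasure_isInvInvariant_centralizer_circleDiagonal_wall`** — hence there IS a Haar measure `νH` on `Z(t_w z₁)` which is right- and inversion-invariant
  (Mathlib `haar` + ★ `isMulRightInvariant_of_modularCharacterFun_eq_one` + ★ `isInvInvariant_of_isMulRightInvariant_of_isClosed`), for the subtype Borel structure the letter uses.
HONEST LABEL: measure bookkeeping; proves nothing about HC_CM, which is proved only modulo the printed citations until rung 0 closes.

## References
* [Rogawski1990] J. D. Rogawski, *Automorphic Representations of Unitary Groups in Three Variables*, Ann. of Math. Stud. 123 (1990), §8.2 p. 122, §1.7 p. 6.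
* [Knapp2002] A. W. Knapp, *Lie Groups Beyond an Introduction*, 2nd ed. (2002), VIII §2 Cor. 8.31 (reductive groups are unimodular).
* [Folland1995] G. B. Folland, *A Course in Abstract Harmonic Analysis* (1995), §2.4 Prop. 2.27, Thm. 2.49.
-/

set_option autoImplicit false

noncomputable section

open MeasureTheory Measure NumberField NumberField.InfinitePlace Topology
open Literature.MeasureTheory.Group

namespace Literature.NumberTheory.Automorphic.UnitaryGroup

section Wall

variable (L : Type) [Field L] (α : Fin 3 → L) (w : {w : InfinitePlace L // IsComplex w})

/-- A diagonal block `(diagonal d).map σ_w` of the frame is hermitian and non-degenerate when the `σ_w d_i` are real and non-zero. [cite: Rogawski1990, §8.2 p. 122] -/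
theorem isHermitian_and_det_ne_zero_diagonal_map_embedding {n : ℕ} (d : Fin n → L) (hd : ∀ i, d i ≠ 0) (hdreal : ∀ i, (w.1.embedding (d i)).im = 0) :
    ((Matrix.diagonal d).map w.1.embedding).IsHermitian ∧ ((Matrix.diagonal d).map w.1.embedding).det ≠ 0 := by
  have hmap : (Matrix.diagonal d).map w.1.embedding = Matrix.diagonal fun i => w.1.embedding (d i) :=
    Matrix.diagonal_map (map_zero _)
  rw [hmap]
  refine ⟨Matrix.isHermitian_diagonal_of_self_adjoint _ ?_, ?_⟩
  · show star (fun i => w.1.embedding (d i)) = fun i => w.1.embedding (d i)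
    funext i
    exact Complex.conj_eq_iff_im.2 (hdreal i)
  · rw [Matrix.det_diagonal]
    exact Finset.prod_ne_zero_iff.2 fun i _ => (map_ne_zero w.1.embedding).2 (hd i)

/-- **THE CENTRALISER OF A NONCOMPACT-WALL TORUS POINT IS UNIMODULAR**: for `z₁ 0 = z₁ 2 ≠ z₁ 1`, `Δ ≡ 1` on `Z_{G_w}(t_w z₁)` — via ★ `Z(t_w z₁) ≃ₜ* U(σ_w diag(α₀,α₂))(ℂ) × U(σ_w α₁)(ℂ)`
and unimodularity of real unitary groups (print: «`H ≅ U(1,1) × U(1)`», reductive). [cite: Rogawski1990, §8.2 p. 122] [cite: Knapp2002, VIII §2 Cor. 8.31] -/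
theorem modularCharacterFun_centralizer_circleDiagonal_wall_eq_one (hα : ∀ i, α i ≠ 0) (hreal : ∀ i, (w.1.embedding (α i)).im = 0)
    {z₁ : Fin 3 → Circle} (h02 : z₁ 0 = z₁ 2) (h01 : z₁ 0 ≠ z₁ 1)
    [hZlc : LocallyCompactSpace (Subgroup.centralizer ({(⟨circleDiagonal 3 z₁, circleDiagonal_mem_archLocal_diagonal L 3 α w z₁⟩ : archLocal L 3 (Matrix.diagonal α) w)} :
      Set (archLocal L 3 (Matrix.diagonal α) w)))]
    (g : Subgroup.centralizer ({(⟨circleDiagonal 3 z₁, circleDiagonal_mem_archLocal_diagonal L 3 α w z₁⟩ : archLocal L 3 (Matrix.diagonal α) w)} :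
      Set (archLocal L 3 (Matrix.diagonal α) w))) :
    modularCharacterFun g = 1 := by
  haveI : LocallyCompactSpace (unitaryGroupOfForm (starRingEnd ℂ) ((Matrix.diagonal ![α 0, α 2]).map w.1.embedding)) :=
    locallyCompactSpace_archLocal L 2 (Matrix.diagonal ![α 0, α 2]) w
  haveI : SecondCountableTopology (unitaryGroupOfForm (starRingEnd ℂ) ((Matrix.diagonal ![α 0, α 2]).map w.1.embedding)) :=
    secondCountableTopology_archLocal L 2 (Matrix.diagonal ![α 0, α 2]) w
  haveI : LocallyCompactSpace (unitaryGroupOfForm (starRingEnd ℂ) ((Matrix.diagonal ![α 1]).map w.1.embedding)) :=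
    locallyCompactSpace_archLocal L 1 (Matrix.diagonal ![α 1]) w
  haveI : SecondCountableTopology (unitaryGroupOfForm (starRingEnd ℂ) ((Matrix.diagonal ![α 1]).map w.1.embedding)) :=
    secondCountableTopology_archLocal L 1 (Matrix.diagonal ![α 1]) w
  -- the same instance for the `unitaryGroupOfForm`-phrased carrier of ★ (V9)'s equivalence (`archLocal` is a `def`)
  haveI : LocallyCompactSpace (Subgroup.centralizer ({(⟨circleDiagonal 3 z₁, circleDiagonal_mem_archLocal_diagonal L 3 α w z₁⟩ :
      unitaryGroupOfForm (starRingEnd ℂ) ((Matrix.diagonal α).map w.1.embedding))} : Set (unitaryGroupOfForm (starRingEnd ℂ) ((Matrix.diagonal α).map w.1.embedding)))) := hZlc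
  obtain ⟨h2, d2⟩ := isHermitian_and_det_ne_zero_diagonal_map_embedding L w ![α 0, α 2] (fun i => by fin_cases i <;> simp [hα]) (fun i => by fin_cases i <;> simp [hreal])
  obtain ⟨h1, d1⟩ := isHermitian_and_det_ne_zero_diagonal_map_embedding L w ![α 1] (fun i => by fin_cases i; simp [hα]) (fun i => by fin_cases i; simp [hreal])
  obtain ⟨e, -⟩ := exists_centralizer_continuousMulEquiv_of_splitSingular L α w h02 h01
  exact modularCharacterFun_eq_one_of_continuousMulEquiv e
    (modularCharacterFun_prod_eq_one (modularCharacterFun_unitaryGroupOfForm_eq_one h2 d2) (modularCharacterFun_unitaryGroupOfForm_eq_one h1 d1)) g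

/-- **`νH` EXISTS: an inversion-invariant (and right-invariant) Haar measure on the centraliser of a noncompact-wall torus point** of `archLocal L 3 (diagonal α) w` — the measure the
letter ★ `ArchLimitFormulaNoncompactWall` quantifies over, for the subtype Borel structure it uses (Mathlib `haar` on the closed, hence locally compact second countable, subgroup;
right invariance from `Δ ≡ 1`; inversion invariance ★ `isInvInvariant_of_isMulRightInvariant_of_isClosed`). [cite: Rogawski1990, §1.7 p. 6] [cite: Folland1995, §2.4 Prop. 2.27] -/
theorem exists_isHaarMeasure_isInvInvariant_centralizer_circleDiagonal_wall
    [MeasurableSpace (archLocal L 3 (Matrix.diagonal α) w)] [BorelSpace (archLocal L 3 (Matrix.diagonal α) w)]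
    (hα : ∀ i, α i ≠ 0) (hreal : ∀ i, (w.1.embedding (α i)).im = 0) {z₁ : Fin 3 → Circle} (h02 : z₁ 0 = z₁ 2) (h01 : z₁ 0 ≠ z₁ 1) :
    ∃ νH : Measure (Subgroup.centralizer ({(⟨circleDiagonal 3 z₁, circleDiagonal_mem_archLocal_diagonal L 3 α w z₁⟩ : archLocal L 3 (Matrix.diagonal α) w)} :
        Set (archLocal L 3 (Matrix.diagonal α) w))),
      νH.IsHaarMeasure ∧ νH.IsMulRightInvariant ∧ νH.IsInvInvariant := by
  haveI : LocallyCompactSpace (archLocal L 3 (Matrix.diagonal α) w) := locallyCompactSpace_archLocal L 3 (Matrix.diagonal α) w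
  haveI : SecondCountableTopology (archLocal L 3 (Matrix.diagonal α) w) := secondCountableTopology_archLocal L 3 (Matrix.diagonal α) w
  have hZ : IsClosed ((Subgroup.centralizer ({(⟨circleDiagonal 3 z₁, circleDiagonal_mem_archLocal_diagonal L 3 α w z₁⟩ : archLocal L 3 (Matrix.diagonal α) w)} :
      Set (archLocal L 3 (Matrix.diagonal α) w))) : Set (archLocal L 3 (Matrix.diagonal α) w)) := isClosed_coe_centralizer_singleton _
  haveI : LocallyCompactSpace (Subgroup.centralizer ({(⟨circleDiagonal 3 z₁, circleDiagonal_mem_archLocal_diagonal L 3 α w z₁⟩ : archLocal L 3 (Matrix.diagonal α) w)} :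
      Set (archLocal L 3 (Matrix.diagonal α) w))) := hZ.isClosedEmbedding_subtypeVal.locallyCompactSpace
  haveI : SecondCountableTopology (Subgroup.centralizer ({(⟨circleDiagonal 3 z₁, circleDiagonal_mem_archLocal_diagonal L 3 α w z₁⟩ : archLocal L 3 (Matrix.diagonal α) w)} :
      Set (archLocal L 3 (Matrix.diagonal α) w))) := TopologicalSpace.Subtype.secondCountableTopology _
  haveI hR : (haar : Measure (Subgroup.centralizer ({(⟨circleDiagonal 3 z₁, circleDiagonal_mem_archLocal_diagonal L 3 α w z₁⟩ : archLocal L 3 (Matrix.diagonal α) w)} :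
      Set (archLocal L 3 (Matrix.diagonal α) w)))).IsMulRightInvariant :=
    isMulRightInvariant_of_modularCharacterFun_eq_one (modularCharacterFun_centralizer_circleDiagonal_wall_eq_one L α w hα hreal h02 h01) _
  exact ⟨haar, inferInstance, hR, isInvInvariant_of_isMulRightInvariant_of_isClosed _ hZ haar⟩

end Wall

end Literature.NumberTheory.Automorphic.UnitaryGroup

end
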